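import Summits.CriticalPhenomena.PercolationContinuityZ3.Theorems.PercNearOneGluingNoHeavyLowerTailCubicThreePointFibreCriterion
import Mathlib.Combinatorics.SimpleGraph.Connectivity.Finite
import HarnessLib

/-!
# `NoHeavyLowerTail` (stmt-CriticalPhenomena-4575) — fibre criterion for SHK3⁺, II: table-driven integer evaluation of the fibre sums

Support file (prover prim-sahi-p2; `--supports stmt-CriticalPhenomena-4575`), continuing `…CubicThreePointFibreCriterion`
(`Fib`, `shk3W_nonneg_of_fib`).  For verification on a concrete graph the fibre sum `Fib(A)` (a real triple sum over
`D.powerset³` with classical cell indicators) is re-expressed as an INTEGER double sum `FibFast` over `S₁, S₂ ⊆ A₁` — the third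
copy of a triple with profile `A` is determined (`mk3`, `eq_mk3_of_data3`) — with the cells read off any table `st` of cell
labels that is correct on `D.powerset` (`cellOK`, a decidable Boolean test using decidable reachability on a finite vertex type);
`Fib_eq_fast`, `shk3W_nonneg_of_fibFast`.  Part III (`…FibreMask`) turns this into pure bitmask arithmetic for `native_decide`.
[cite: Gladkov2024StrongFKG, Cor. 4.2 (the cubic row SHK3⁺ ⊇ AG)]
-/

namespace Summit.CriticalPhenomena.PercolationContinuityZ3.Theorems

namespace TerminalGluing

open Finset SimpleGraph Literature.Probability.Percolation Literature.Probability.Percolation.DecisionTree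
open CubicThreePointStep CubicThreePointTerminal

variable {V : Type*} [DecidableEq V]

/-! ### Fast (integer, table-driven) evaluation of the fibre sums -/

section Fast

/-- Unit vector component, over `ℤ`. [folklore] -/
def uZ (s k : Fin 5) : ℤ := if s = k then 1 else 0

/-- Unit vector component, over `ℝ`. [folklore] -/
noncomputable def uR (s k : Fin 5) : ℝ := if s = k then 1 else 0

/-- The integer value of `Pol6` at three unit cell vectors (cell labels `0=Q,1=U₁,2=U₂,3=U₃,4=T`). [folklore] -/
def PolZ (s₁ s₂ s₃ : Fin 5) : ℤ :=
  Pol6 (uZ s₁ 0) (uZ s₁ 1) (uZ s₁ 2) (uZ s₁ 3) (uZ s₁ 4) (uZ s₂ 0) (uZ s₂ 1) (uZ s₂ 2) (uZ s₂ 3) (uZ s₂ 4)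
    (uZ s₃ 0) (uZ s₃ 1) (uZ s₃ 2) (uZ s₃ 3) (uZ s₃ 4)

/-- Casting `PolZ` to `ℝ`. [folklore] -/
theorem PolZ_cast (s₁ s₂ s₃ : Fin 5) :
    ((PolZ s₁ s₂ s₃ : ℤ) : ℝ) = Pol6 (uR s₁ 0) (uR s₁ 1) (uR s₁ 2) (uR s₁ 3) (uR s₁ 4) (uR s₂ 0) (uR s₂ 1) (uR s₂ 2)
      (uR s₂ 3) (uR s₂ 4) (uR s₃ 0) (uR s₃ 1) (uR s₃ 2) (uR s₃ 3) (uR s₃ 4) := by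
  have hc : ∀ s k : Fin 5, ((uZ s k : ℤ) : ℝ) = uR s k := by
    intro s k; unfold uZ uR; split_ifs <;> simp
  simp only [PolZ, Pol6, F, Int.cast_add, Int.cast_sub, Int.cast_mul, hc]

/-- The third copy determined by a profile and the first two copies. [folklore] -/
def mk3 (A : Finset (Sym2 V) × Finset (Sym2 V) × Finset (Sym2 V)) (S₁ S₂ : Finset (Sym2 V)) : Finset (Sym2 V) :=
  A.2.2 ∪ ((A.2.1 \ A.2.2) \ (S₁ ∩ S₂)) ∪ ((A.1 \ A.2.1) \ (S₁ ∪ S₂))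

/-- A triple with profile `A` has its third member determined by the first two. [folklore] -/
theorem eq_mk3_of_data3 {A : Finset (Sym2 V) × Finset (Sym2 V) × Finset (Sym2 V)} {S₁ S₂ S₃ : Finset (Sym2 V)}
    (h : data3 S₁ S₂ S₃ = A) : S₃ = mk3 A S₁ S₂ := by
  subst h
  ext e
  dsimp only [mk3, data3]
  simp only [Finset.mem_union, Finset.mem_sdiff, Finset.mem_inter]
  by_cases h₁ : e ∈ S₁ <;> by_cases h₂ : e ∈ S₂ <;> by_cases h₃ : e ∈ S₃ <;> simp [h₁, h₂, h₃]

/-- A profile is nested: triple intersection ⊆ pairwise ⊆ union. [folklore] -/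
theorem data3_nested (S₁ S₂ S₃ : Finset (Sym2 V)) :
    (data3 S₁ S₂ S₃).2.2 ⊆ (data3 S₁ S₂ S₃).2.1 ∧ (data3 S₁ S₂ S₃).2.1 ⊆ (data3 S₁ S₂ S₃).1 := by
  dsimp only [data3]
  constructor
  · intro e he; simp only [Finset.mem_inter, Finset.mem_union] at he ⊢; tauto
  · intro e he; simp only [Finset.mem_inter, Finset.mem_union] at he ⊢; tauto

/-- In a triple with profile `A` the copies lie between `A.2.2` and `A.1`. [folklore] -/
theorem bounds_of_data3 {A : Finset (Sym2 V) × Finset (Sym2 V) × Finset (Sym2 V)} {S₁ S₂ S₃ : Finset (Sym2 V)}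
    (h : data3 S₁ S₂ S₃ = A) : A.2.2 ⊆ S₁ ∧ A.2.2 ⊆ S₂ ∧ S₁ ⊆ A.1 ∧ S₂ ⊆ A.1 ∧ S₃ ⊆ A.1 := by
  subst h
  dsimp only [data3]
  refine ⟨?_, ?_, ?_, ?_, ?_⟩
  · exact Finset.inter_subset_left.trans Finset.inter_subset_left
  · exact Finset.inter_subset_left.trans Finset.inter_subset_right
  · exact Finset.subset_union_left.trans Finset.subset_union_left
  · exact Finset.subset_union_right.trans Finset.subset_union_left
  · exact Finset.subset_union_right

variable (D : Finset (Sym2 V)) (K : Finset (Sym2 V)) (a b c : V)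

/-- Reachability with forced edges is decidable on a finite vertex type. [folklore] -/
instance decR [Fintype V] (K S : Finset (Sym2 V)) (x y : V) : Decidable (R K S x y) :=
  haveI : DecidablePred (· ∈ (↑(S ∪ K) : Set (Sym2 V))) := fun e => inferInstanceAs (Decidable (e ∈ S ∪ K))
  inferInstanceAs (Decidable ((fromEdgeSet (↑(S ∪ K) : Set (Sym2 V))).Reachable x y))

/-- Membership in the cell `a|b|c` is decidable on a finite vertex type. [folklore] -/
instance decMemEvQ [Fintype V] (S : Finset (Sym2 V)) : Decidable (S ∈ evQ K a b c) :=
  inferInstanceAs (Decidable (¬ R K S a b ∧ ¬ R K S a c ∧ ¬ R K S b c))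

/-- Membership in the cell `ab|c` is decidable on a finite vertex type. [folklore] -/
instance decMemEvU₁ [Fintype V] (S : Finset (Sym2 V)) : Decidable (S ∈ evU₁ K a b c) :=
  inferInstanceAs (Decidable (R K S a b ∧ ¬ R K S a c))

/-- Membership in the cell `ac|b` is decidable on a finite vertex type. [folklore] -/
instance decMemEvU₂ [Fintype V] (S : Finset (Sym2 V)) : Decidable (S ∈ evU₂ K a b c) :=
  inferInstanceAs (Decidable (R K S a c ∧ ¬ R K S a b))

/-- Membership in the cell `bc|a` is decidable on a finite vertex type. [folklore] -/
instance decMemEvU₃ [Fintype V] (S : Finset (Sym2 V)) : Decidable (S ∈ evU₃ K a b c) :=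
  inferInstanceAs (Decidable (R K S b c ∧ ¬ R K S a b))

/-- Membership in the cell `abc` is decidable on a finite vertex type. [folklore] -/
instance decMemEvT [Fintype V] (S : Finset (Sym2 V)) : Decidable (S ∈ evT K a b c) :=
  inferInstanceAs (Decidable (R K S a b ∧ R K S a c))

/-- Boolean test that a cell label is correct at `S`: label `0,1,2,3,4` means `S ∈ evQ, evU₁, evU₂, evU₃, evT`. [folklore] -/
def cellOK [Fintype V] (S : Finset (Sym2 V)) (s : Fin 5) : Bool :=
  decide ((s = 0 ∧ S ∈ evQ K a b c) ∨ (s = 1 ∧ S ∈ evU₁ K a b c) ∨ (s = 2 ∧ S ∈ evU₂ K a b c) ∨ (s = 3 ∧ S ∈ evU₃ K a b c)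
    ∨ (s = 4 ∧ S ∈ evT K a b c))

/-- `uR s s = 1`. [folklore] -/
theorem uR_self (s : Fin 5) : uR s s = 1 := by simp [uR]

/-- `uR s k = 0` for `s ≠ k`. [folklore] -/
theorem uR_ne {s k : Fin 5} (h : s ≠ k) : uR s k = 0 := by simp [uR, h]

/-- A correct label determines the five cell indicators. [folklore] -/
theorem ind_of_cellOK [Fintype V] {S : Finset (Sym2 V)} {s : Fin 5} (h : cellOK K a b c S s = true) :
    ind (evQ K a b c) S = uR s 0 ∧ ind (evU₁ K a b c) S = uR s 1 ∧ ind (evU₂ K a b c) S = uR s 2 ∧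
      ind (evU₃ K a b c) S = uR s 3 ∧ ind (evT K a b c) S = uR s 4 := by
  have h' := of_decide_eq_true h
  rcases h' with ⟨rfl, hm⟩ | ⟨rfl, hm⟩ | ⟨rfl, hm⟩ | ⟨rfl, hm⟩ | ⟨rfl, hm⟩
  · have hm' := (mem_evQ (K := K) (a := a) (b := b) (c := c)).mp hm
    have h₁ : S ∉ evU₁ K a b c := fun h' => hm'.1 (mem_evU₁.mp h').1
    have h₂ : S ∉ evU₂ K a b c := fun h' => hm'.2.1 (mem_evU₂.mp h').1
    have h₃ : S ∉ evU₃ K a b c := fun h' => hm'.2.2 (mem_evU₃.mp h').1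
    have hT : S ∉ evT K a b c := fun h' => hm'.1 (mem_evT.mp h').1
    rw [ind_of_mem hm, ind_of_not_mem h₁, ind_of_not_mem h₂, ind_of_not_mem h₃, ind_of_not_mem hT, uR_self,
      uR_ne (by decide), uR_ne (by decide), uR_ne (by decide), uR_ne (by decide)]
    exact ⟨rfl, rfl, rfl, rfl, rfl⟩
  · have hm' := (mem_evU₁ (K := K) (a := a) (b := b) (c := c)).mp hm
    have hQ : S ∉ evQ K a b c := fun h' => (mem_evQ.mp h').1 hm'.1
    have h₂ : S ∉ evU₂ K a b c := fun h' => (mem_evU₂.mp h').2 hm'.1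
    have h₃ : S ∉ evU₃ K a b c := fun h' => (mem_evU₃.mp h').2 hm'.1
    have hT : S ∉ evT K a b c := fun h' => hm'.2 (mem_evT.mp h').2
    rw [ind_of_not_mem hQ, ind_of_mem hm, ind_of_not_mem h₂, ind_of_not_mem h₃, ind_of_not_mem hT, uR_self,
      uR_ne (by decide), uR_ne (by decide), uR_ne (by decide), uR_ne (by decide)]
    exact ⟨rfl, rfl, rfl, rfl, rfl⟩
  · have hm' := (mem_evU₂ (K := K) (a := a) (b := b) (c := c)).mp hm
    have hQ : S ∉ evQ K a b c := fun h' => (mem_evQ.mp h').2.1 hm'.1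
    have h₁ : S ∉ evU₁ K a b c := fun h' => hm'.2 (mem_evU₁.mp h').1
    have h₃ : S ∉ evU₃ K a b c := fun h' => hm'.2 (hm'.1.trans (mem_evU₃.mp h').1.symm)
    have hT : S ∉ evT K a b c := fun h' => hm'.2 (mem_evT.mp h').1
    rw [ind_of_not_mem hQ, ind_of_not_mem h₁, ind_of_mem hm, ind_of_not_mem h₃, ind_of_not_mem hT, uR_self,
      uR_ne (by decide), uR_ne (by decide), uR_ne (by decide), uR_ne (by decide)]
    exact ⟨rfl, rfl, rfl, rfl, rfl⟩
  · have hm' := (mem_evU₃ (K := K) (a := a) (b := b) (c := c)).mp hm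
    have hac : ¬ R K S a c := fun hac => hm'.2 (hac.trans hm'.1.symm)
    have hQ : S ∉ evQ K a b c := fun h' => (mem_evQ.mp h').2.2 hm'.1
    have h₁ : S ∉ evU₁ K a b c := fun h' => hm'.2 (mem_evU₁.mp h').1
    have h₂ : S ∉ evU₂ K a b c := fun h' => hac (mem_evU₂.mp h').1
    have hT : S ∉ evT K a b c := fun h' => hm'.2 (mem_evT.mp h').1
    rw [ind_of_not_mem hQ, ind_of_not_mem h₁, ind_of_not_mem h₂, ind_of_mem hm, ind_of_not_mem hT, uR_self,
      uR_ne (by decide), uR_ne (by decide), uR_ne (by decide), uR_ne (by decide)]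
    exact ⟨rfl, rfl, rfl, rfl, rfl⟩
  · have hm' := (mem_evT (K := K) (a := a) (b := b) (c := c)).mp hm
    have hQ : S ∉ evQ K a b c := fun h' => (mem_evQ.mp h').1 hm'.1
    have h₁ : S ∉ evU₁ K a b c := fun h' => (mem_evU₁.mp h').2 hm'.2
    have h₂ : S ∉ evU₂ K a b c := fun h' => (mem_evU₂.mp h').2 hm'.1
    have h₃ : S ∉ evU₃ K a b c := fun h' => (mem_evU₃.mp h').2 hm'.1
    rw [ind_of_not_mem hQ, ind_of_not_mem h₁, ind_of_not_mem h₂, ind_of_not_mem h₃, ind_of_mem hm, uR_self,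
      uR_ne (by decide), uR_ne (by decide), uR_ne (by decide), uR_ne (by decide)]
    exact ⟨rfl, rfl, rfl, rfl, rfl⟩

variable (st : Finset (Sym2 V) → Fin 5)

/-- The fast integer fibre sum: enumerate the first two copies inside `A.1`, determine the third, read cells from the table `st`. [folklore] -/
def FibFast (A : Finset (Sym2 V) × Finset (Sym2 V) × Finset (Sym2 V)) : ℤ :=
  ∑ S₁ ∈ A.1.powerset, ∑ S₂ ∈ A.1.powerset,
    if A.2.2 ⊆ S₁ ∧ A.2.2 ⊆ S₂ ∧ data3 S₁ S₂ (mk3 A S₁ S₂) = A then PolZ (st S₁) (st S₂) (st (mk3 A S₁ S₂)) else 0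

/-- With a correct table, `polInd` of a triple inside `D` is the cast of `PolZ` of the labels. [folklore] -/
theorem polInd_eq_cast [Fintype V] (hst : ∀ S ∈ D.powerset, cellOK K a b c S (st S) = true) {S₁ S₂ S₃ : Finset (Sym2 V)}
    (h₁ : S₁ ⊆ D) (h₂ : S₂ ⊆ D) (h₃ : S₃ ⊆ D) :
    polInd K a b c S₁ S₂ S₃ = ((PolZ (st S₁) (st S₂) (st S₃) : ℤ) : ℝ) := by
  obtain ⟨e₁, e₂, e₃, e₄, e₅⟩ := ind_of_cellOK K a b c (hst S₁ (Finset.mem_powerset.mpr h₁))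
  obtain ⟨f₁, f₂, f₃, f₄, f₅⟩ := ind_of_cellOK K a b c (hst S₂ (Finset.mem_powerset.mpr h₂))
  obtain ⟨g₁, g₂, g₃, g₄, g₅⟩ := ind_of_cellOK K a b c (hst S₃ (Finset.mem_powerset.mpr h₃))
  rw [PolZ_cast, polInd, e₁, e₂, e₃, e₄, e₅, f₁, f₂, f₃, f₄, f₅, g₁, g₂, g₃, g₄, g₅]

/-- **The fibre sum equals the fast integer fibre sum** (for profiles inside `D`, given a correct cell table). [folklore] -/
theorem Fib_eq_fast [Fintype V] (hst : ∀ S ∈ D.powerset, cellOK K a b c S (st S) = true)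
    {A : Finset (Sym2 V) × Finset (Sym2 V) × Finset (Sym2 V)} (hA : A.1 ⊆ D) :
    Fib D K a b c A = ((FibFast st A : ℤ) : ℝ) := by
  unfold Fib FibFast
  -- Step 1: the innermost sum has at most one nonzero term, at `mk3 A S₁ S₂`.
  have inner : ∀ S₁ ∈ D.powerset, ∀ S₂ ∈ D.powerset,
      (∑ S₃ ∈ D.powerset, if data3 S₁ S₂ S₃ = A then polInd K a b c S₁ S₂ S₃ else 0) =
      if A.2.2 ⊆ S₁ ∧ A.2.2 ⊆ S₂ ∧ data3 S₁ S₂ (mk3 A S₁ S₂) = A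
        then (((PolZ (st S₁) (st S₂) (st (mk3 A S₁ S₂)) : ℤ) : ℝ)) else 0 := by
    intro S₁ hS₁ S₂ hS₂
    rw [Finset.mem_powerset] at hS₁ hS₂
    by_cases hd : data3 S₁ S₂ (mk3 A S₁ S₂) = A
    · obtain ⟨b₁, b₂, -, -, b₃⟩ := bounds_of_data3 hd
      rw [if_pos ⟨b₁, b₂, hd⟩]
      rw [Finset.sum_eq_single_of_mem (mk3 A S₁ S₂) (Finset.mem_powerset.mpr (b₃.trans hA))]
      · rw [if_pos hd, polInd_eq_cast D K a b c st hst hS₁ hS₂ (b₃.trans hA)]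
      · intro S₃ _ hne
        rw [if_neg]
        intro hd'
        exact hne (eq_mk3_of_data3 hd')
    · rw [if_neg (fun h => hd h.2.2)]
      refine Finset.sum_eq_zero fun S₃ _ => ?_
      rw [if_neg]
      intro hd'
      exact hd (eq_mk3_of_data3 hd' ▸ hd')
  rw [Finset.sum_congr rfl (fun S₁ hS₁ => Finset.sum_congr rfl (fun S₂ hS₂ => inner S₁ hS₁ S₂ hS₂))]
  -- Step 2: restrict both outer sums to `A.1.powerset`.
  have hsub : A.1.powerset ⊆ D.powerset := Finset.powerset_mono.mpr hA
  push_cast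
  symm
  apply Finset.sum_subset_zero_on_sdiff hsub
  · intro S₁ hS₁
    rw [Finset.mem_sdiff] at hS₁
    refine Finset.sum_eq_zero fun S₂ _ => ?_
    rw [if_neg]
    intro h
    exact hS₁.2 (Finset.mem_powerset.mpr (bounds_of_data3 h.2.2).2.2.1)
  · intro S₁ _
    apply Finset.sum_subset_zero_on_sdiff hsub
    · intro S₂ hS₂
      rw [Finset.mem_sdiff] at hS₂
      rw [if_neg]
      intro h
      exact hS₂.2 (Finset.mem_powerset.mpr (bounds_of_data3 h.2.2).2.2.2.1)
    · intro S₂ _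
      rfl

/-- **Fibre criterion, computable form.**  Given a cell table correct on `D.powerset` and nonnegativity of all fast fibre sums over NESTED profiles
`A₃ ⊆ A₂ ⊆ A₁ ⊆ D` (a finite check), SHK3⁺ holds for all weights in `[0,1]`. [folklore] -/
theorem shk3W_nonneg_of_fibFast [Fintype V] (p : Sym2 V → ℝ) (hp0 : ∀ e, 0 ≤ p e) (hp1 : ∀ e, p e ≤ 1)
    (hst : ∀ S ∈ D.powerset, cellOK K a b c S (st S) = true)
    (hcheck : ∀ A₁ ∈ D.powerset, ∀ A₂ ∈ A₁.powerset, ∀ A₃ ∈ A₂.powerset, 0 ≤ FibFast st (A₁, A₂, A₃)) :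
    0 ≤ shk3W D p K a b c := by
  refine shk3W_nonneg_of_fib D p K a b c hp0 hp1 fun A hA => ?_
  obtain ⟨A₁, A₂, A₃⟩ := A
  simp only [Finset.mem_product] at hA
  by_cases hn : A₃ ⊆ A₂ ∧ A₂ ⊆ A₁
  · have hA1 : A₁ ⊆ D := Finset.mem_powerset.mp hA.1
    rw [Fib_eq_fast D K a b c st hst (A := (A₁, A₂, A₃)) hA1]
    exact_mod_cast hcheck A₁ hA.1 A₂ (Finset.mem_powerset.mpr hn.2) A₃ (Finset.mem_powerset.mpr hn.1)
  · -- a non-nested profile has an empty fibre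
    unfold Fib
    refine le_of_eq (Eq.symm (Finset.sum_eq_zero fun S₁ _ => Finset.sum_eq_zero fun S₂ _ => Finset.sum_eq_zero fun S₃ _ => ?_))
    rw [if_neg]
    intro h
    have := data3_nested S₁ S₂ S₃
    rw [h] at this
    exact hn this

end Fast

end TerminalGluing

end Summit.CriticalPhenomena.PercolationContinuityZ3.Theorems
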